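import Summits.BirchSwinnertonDyer.BirchSwinnertonDyer.Theorems.ClassRecordThreeCornerTwinHalvesDefs
import Summits.BirchSwinnertonDyer.BirchSwinnertonDyer.Theorems.ClassRecordThreeCornerAtThreeTwinLowerSupplyDefs
import Summits.BirchSwinnertonDyer.BirchSwinnertonDyer.Theorems.ClassRecordThreeCornerAtThreeUpperModEightConsumed
import Literature.NumberTheory.QuadraticFields.KroneckerSplitting
import HarnessLib

/-!
# Routes `ClassRecordThree` ∕ `KolyvaginRoadThree` (rung K2@3), crux `CornerAtThreeW` (item stmt-BirchSwinnertonDyer-21420;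
# 19111 `CornerAtThree` aside): the twin's `≥`-half at a CLASSICAL Heegner frame with `d_K ≡ 1 (mod 8)` — the one twin input the
# MONO-carrier branch of conjunct (U) consumes — definitions home (cell `bsd-stepL`, seat `bsd-stepL-corner3-p2` g6 = WIDTH-LEVER
# lane B; `--supports stmt-BirchSwinnertonDyer-21420 --as helper`)

Theses-free. Contents: ONE `Prop`-valued predicate `CornerTwinHalves.CornerTwinLowerModEightAt W` (tagged `@[conjecture]`: card J's F1′
`CornerTwinLowerAt W` with the one extra frame clause `d_K ≡ 1 (mod 8)`; implied by BSD of one Hoffstein–Luo twist), its class-wide form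
`CornerTwinLowerModEight` (`@[conjecture]`, a `Prop` constant), and THREE bookkeeping theorems: it forgets to F1′; it is IMPLIED by the ∀-twist
conjunct `X11b.Three.CornerTwistAt W` (Hoffstein–Luo's field has `d ≡ 1 (mod 8)` by statement: corner-p1 g12's
`exists_admissibleFieldModEight_of_rootNumber_eq_neg_one`); and — on EVEN-conductor corner curves — it is IMPLIED by the TWIN-LOWER SUPPLY
`Theorems.FHTwinLowerSupplyAt W 3` of conjunct 4 (r3) at the empty inert set (`2 ∣ N` split in `K` forces `d_K ≡ 1 (mod 8)`, Marcus Thm. 25 ∕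
`Quadratic.ncard_primesOver_two_eq_two_iff`). NO named fact, no instance, no notation, no `sorry`.

## Why (lane card `HOME/corner3/g6/inertW_r4.md`, RULING 40 (α) note; lane B memo CORNER3-G6.md)

On the registered line `Cruxes/CornerAtThreeW/Lines/inert.lean` (r3) the MONO-carrier branch of `residual3_of_stubs` is corner-p1 g12's END
`Three.missingUpperBoundAt_monoCarrier_of_threeNamedFacts_of_facts` (p575586): the Jetchev MAX walk at `3` on a Hoffstein–Luo frame with
`d_K ≡ 1 (mod 8)` that the END books itself, where it consumes the corner's ∀-twist conjunct `CornerTwistAt W` (`BSD₃` of the twist at EVERY odd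
Heegner field) — but only through the twin's `≥`-half at THAT frame (`pPartRankZero_of_cornerTwistAt … |>.le`). So the mono branch needs exactly
«ONE classical odd Heegner frame with `d_K ≡ 1 (mod 8)` whose twin carries its `≥`-half» = `CornerTwinLowerModEightAt W` (FREE at an exact twin:
`CornerTwinHalves.twinLower_of_exact`; per pair a finite certificate — mult-p3 g5's DH census: an exact odd Heegner twin with `d ≡ 1 (mod 8)` on
296 ∕ 296 pairs for even `N` (automatic) and on 61 ∕ 61 odd-`N` pairs (`DH-oddN-split2-witnesses.tsv`); this seat's census j292957, rows `T = ∅`,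
even `N`). Consequences: (i) under plan g38's RULING 40 (α) (witness-shaped line, ONE `stub_cornerTwistWitness3`) the mono branch composes from
this object instead of the ∀-twist stubs (the witness frame need not be `≡ 1 (mod 8)` for odd `N`); (ii) already under the line of record the mono
branch's dependence on `stub_cornerTwistLower3 ∕ stub_cornerTwistMuAn3` (rank-0 `BSD₃` of a whole Waldspurger family) drops to this per-pair
certifiable input — the companion file `…CornerAtThreeUpperModEightOfTwinLower.lean` is the END re-keyed on it; (iii) on even-`N` corner curves the
object follows from conjunct 4's `FHTwinLowerSupplyAt W 3` (this file, §2), so there the mono branch needs NO twist input at all.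

HONEST FRAMING: typed SHAPES and bookkeeping; CONDITIONAL wherever used; nothing booked; no census word, tier or label moves (T7); item
21420 is NOT closed; the class-wide statement is beyond print at `3 ∣ N` exactly like card F's F1 (Ono–Skinner ∕ James–Ono at `ℓ = 3`); BSD(E,3)
is proved for no class by this file.

References: [HoffsteinLuo1997] Theorem (§1, pp. 435–436; `2 ∈ S` gives `d ≡ 1 (mod 8)`); [Marcus2018] Ch. 3 Thm. 25; [Jetchev2008] Thm. 1.4,
Cor. 1.5; [Skinner2016PacificMC] Thm. C (display shape of the `≥`-half); [Miller2011LMS] Def. 1.1; card J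
(`Cruxes/CornerAtThreeW/Ideas/two-twin-half-squeeze-at-3.md`); cell board RULING 38 ∕ RULING 40 (2026-08-27).
-/

set_option linter.dupNamespace false

open scoped Classical

open WeierstrassCurve NumberField IsDedekindDomain Field Literature.NumberTheory.EllipticCurves
  Rat.HeightOneSpectrum
  Literature.NumberTheory.DiophantineGeometry
  Literature.NumberTheory.EllipticCurves.ModularForms
  Literature.NumberTheory.EllipticCurves.Rank1Residual
  Literature.NumberTheory.EllipticCurves.Rank1Residual.Typed
  Literature.NumberTheory.QuadraticFields.Quadratic
  Literature.NumberTheory.GaloisRepresentations Literature.NumberTheory.GaloisCohomology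
  Summit.BirchSwinnertonDyer.Rank1Residual
  Summit.BirchSwinnertonDyer.Rank1Residual.X11b
  Summit.BirchSwinnertonDyer.Rank1Residual.X11b.Three
  Summit.BirchSwinnertonDyer.BirchSwinnertonDyer.Theorems

namespace Summit.BirchSwinnertonDyer.BirchSwinnertonDyer.Theorems.CornerTwinHalves

/-! ### §1. The typed input -/

/-- OPEN (typed open input; implied by the `≥`-half of `BSD(E^{d_K},3)` for one Hoffstein–Luo twist) — **F1′ at a `d_K ≡ 1 (mod 8)`
frame, `CornerTwinLowerModEightAt W`**: for `W/ℚ` globally minimal with `(E,3) ∈` X11b and `ρ̄_{E,3}` NOT surjective there is SOME odd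
Heegner twin frame (`IsTwinFrame`: `K` imaginary quadratic, `d_K` odd, `d_K < −4`, Heegner for `N(E)` and for `3`, `L(E^{(d_K)},1) ≠ 0`, a
global minimal model `Wd = Cd • E^{(d_K)}`) WITH `d_K ≡ 1 (mod 8)` (`2` split in `K`: no Kolyvagin prime `ℓ = 2`, RULING 38) and a rational
`q = L(Wd,1)/Ω(Wd)` carrying the twin's `≥`-half `ord₃ q ≤ ord₃ #Ш(Wd) + ord₃ ∏c(Wd) − 2·ord₃ #tors(Wd)` (FREE at an exact twin). Exactly what
the MONO-carrier END `Three.missingUpperBoundAt_of_jetchevMaxModEightAt_of_irreducible` uses of `CornerTwistAt W`. WEAKER than `CornerTwistAt W`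
(`cornerTwinLowerModEightAt_of_cornerTwistAt`); on even `N` WEAKER than `FHTwinLowerSupplyAt W 3` (`…_of_fhTwinLowerSupplyAt_of_two_dvd`).
A predicate on `W`; NEVER a theorem in this cell; CONDITIONAL wherever used.
[cite: HoffsteinLuo1997, Theorem (§1, pp. 435–436) (such a frame exists; shape only)]
[cite: Skinner2016PacificMC, Thm. C (display shape of the `≥`-half; VOID on the rank-0 corner — nothing asserted)] -/
@[conjecture]
def CornerTwinLowerModEightAt (W : WeierstrassCurve ℚ) [W.IsElliptic] [W.IsGloballyMinimal] : Prop :=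
  ClassX11b W 3 → ¬ Surj W 3 →
    ∃ (K : Type) (_ : Field K) (_ : NumberField K)
      (Wd : WeierstrassCurve ℚ) (_ : Wd.IsElliptic) (_ : Wd.IsGloballyMinimal) (Cd : VariableChange ℚ),
      IsTwinFrame W K Wd Cd ∧ NumberField.discr K % 8 = 1 ∧
        ∃ q : ℚ, Wd.entireLFunction 1 / (Wd.realPeriodRat : ℂ) = (q : ℂ) ∧
          padicValRat 3 q ≤ (padicValNat 3 Wd.shaOrder : ℤ) + padicValNat 3 Wd.tamagawaProduct -
            2 * padicValNat 3 Wd.torsionOrder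

/-- OPEN — **`CornerTwinLowerModEight`**: the class-wide form (`∀ W, CornerTwinLowerModEightAt W`), the proposed per-pair-certifiable input of the
MONO-carrier branch of conjunct (U) of crux `CornerAtThreeW` (planner action). A `Prop` constant; nothing asserted.
[cite: HoffsteinLuo1997, Theorem (§1) (shape only)] -/
@[conjecture]
def CornerTwinLowerModEight : Prop :=
  ∀ (W : WeierstrassCurve ℚ) [W.IsElliptic] [W.IsGloballyMinimal], CornerTwinLowerModEightAt W

/-! ### §2. Bookkeeping: forget to F1′; ⟸ the ∀-twist conjunct; ⟸ the twin-lower supply on even `N` -/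

/-- Forget the frame clause: `CornerTwinLowerModEightAt W → CornerTwinLowerAt W` (card J's F1′). Bookkeeping. [cite: Miller2011LMS, Def. 1.1] -/
theorem cornerTwinLowerAt_of_modEight (W : WeierstrassCurve ℚ) [W.IsElliptic] [W.IsGloballyMinimal]
    (h : CornerTwinLowerModEightAt W) : CornerTwinLowerAt W := by
  intro hX hns
  obtain ⟨K, _, _, Wd, _, _, Cd, hfr, -, q, hq, hv⟩ := h hX hns
  exact ⟨K, inferInstance, inferInstance, Wd, inferInstance, inferInstance, Cd, hfr, q, hq, hv⟩

/-- **`CornerTwinLowerModEightAt W` ⟸ the ∀-twist conjunct `CornerTwistAt W`**: Hoffstein–Luo's admissible field WITH `d ≡ 1 (mod 8)`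
exported (corner-p1 g12's `exists_admissibleFieldModEight_of_rootNumber_eq_neg_one`; sign `−1` from `r_an = 1` by modularity), a global
minimal model of the twist (Néron), `BSDp Wd 3` from `CornerTwistAt W` there, and the `≥`-half from it
(`exists_LOne_div_realPeriodRat_of_bsdp_rankZero`). Bookkeeping; CONDITIONAL on `hnf`, `hHL`, `hGZK`, `hmod` and (Tw).
-- adapted from Summits/BirchSwinnertonDyer/BirchSwinnertonDyer/Theorems/ClassRecordThreeCornerTwistWitnessDefs.lean
[cite: HoffsteinLuo1997, Theorem (§1, pp. 435–436)] [cite: Miller2011LMS, Def. 1.1] -/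
theorem cornerTwinLowerModEightAt_of_cornerTwistAt (hnf : exists_isNewformOf)
    (hHL : HoffsteinLuo1997_exists_twist_L_one_ne_zero)
    (hGZK : rank_eq_analyticRank_of_analyticRank_le_one) (hmod : hasEntireLFunction_rat)
    (W : WeierstrassCurve ℚ) [W.IsElliptic] [W.IsGloballyMinimal]
    (hTw : CornerTwistAt W) : CornerTwinLowerModEightAt W := by
  intro hX hns
  haveI : Fact (Nat.Prime 3) := ⟨Nat.prime_three⟩
  have hr : W.analyticRank = 1 := hX.1
  have hw : W.rootNumber = -1 := by
    rw [WeierstrassCurve.rootNumber_eq_neg_one_pow_analyticRank_of_exists_isNewformOf hnf W, hr]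
    norm_num
  obtain ⟨K, _, _, hK, hodd, hd8, hlt, hHN, hH3, hLt⟩ :=
    exists_admissibleFieldModEight_of_rootNumber_eq_neg_one hnf hHL W hw 3
  have hD0 : (NumberField.discr K : ℚ) ≠ 0 := by exact_mod_cast NumberField.discr_ne_zero K
  haveI hEt : (W.quadraticTwist (NumberField.discr K : ℚ)).IsElliptic := W.isElliptic_quadraticTwist hD0
  obtain ⟨Cd, hCd⟩ := hasGlobalMinimalModel_rat_holds (W.quadraticTwist (NumberField.discr K : ℚ))
  haveI := hCd
  set Wd : WeierstrassCurve ℚ := Cd • W.quadraticTwist (NumberField.discr K : ℚ) with hWd_def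
  have hWd : Cd • W.quadraticTwist (NumberField.discr K : ℚ) = Wd := rfl
  have hbsd : BSDp Wd 3 := hTw K Wd Cd hX hns hK hodd hHN hLt hWd
  have hLt' : (W.quadraticTwist (NumberField.discr K : ℚ)).entireLFunction = Wd.entireLFunction := by
    rw [← hWd, entireLFunction_smul]
  have hLd1 : Wd.entireLFunction 1 ≠ 0 := by rw [← hLt']; exact hLt
  have hrd : Wd.analyticRank = 0 := (Wd.analyticRank_eq_zero_iff_holds (hmod Wd)).2 hLd1
  obtain ⟨qd, hqd, hvqd⟩ := exists_LOne_div_realPeriodRat_of_bsdp_rankZero hGZK hmod Wd 3 hrd hbsd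
  exact ⟨K, inferInstance, inferInstance, Wd, inferInstance, hCd, Cd, ⟨hK, hodd, hlt, hHN, hH3, hLt, hWd⟩, hd8,
    qd, hqd, hvqd.le⟩

/-- **On EVEN conductor, `CornerTwinLowerModEightAt W` ⟸ the TWIN-LOWER SUPPLY `FHTwinLowerSupplyAt W 3` at the EMPTY inert set**
(conjunct 4 of r3): the supplied frame has every bad prime split — so it is Heegner for `N(E)` (by definition) and for `3` (`3 ∣ N(E)`:
multiplicative at `3`), `2 ∣ N(E)` split gives `d_K ≡ 1 (mod 8)` (`Quadratic.ncard_primesOver_two_eq_two_iff`), hence `d_K` odd, and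
`|d_K| > 4` with `d_K < 0` gives `d_K < −4`; the twist, its model and its `≥`-half come with the frame. So on the 235 even-`N` corner pairs
(census) the mono branch needs NO twist input beyond conjunct 4. Bookkeeping; CONDITIONAL on the supply.
[cite: Marcus2018, Ch. 3 Thm. 25 (decomposition law at 2)] [cite: Miller2011LMS, Def. 1.1] -/
theorem cornerTwinLowerModEightAt_of_fhTwinLowerSupplyAt_of_two_dvd
    (W : WeierstrassCurve ℚ) [W.IsElliptic] [W.IsGloballyMinimal]
    (h2N : 2 ∣ W.conductorNorm ℤ) (hTL : FHTwinLowerSupplyAt W 3) : CornerTwinLowerModEightAt W := by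
  intro hX _
  haveI : Fact (Nat.Prime 3) := ⟨Nat.prime_three⟩
  obtain ⟨-, -, hmult, -⟩ := id hX
  obtain ⟨K, _, _, Wd, _, hCd, Cd, hK, hdisc, -, hsplitN, hLt, hWd, q, hq, hv⟩ :=
    hTL ∅ (fun ℓ hℓ ↦ absurd hℓ (Finset.notMem_empty ℓ)) ⟨0, rfl⟩
  have hHN : SatisfiesHeegnerHypothesis (W.conductorNorm ℤ) K :=
    fun ℓ hℓ hℓN ↦ hsplitN ℓ hℓ hℓN (Finset.notMem_empty ℓ)
  have h3N : 3 ∣ W.conductorNorm ℤ :=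
    (W.dvd_conductorNorm_iff_not_hasGoodReductionAtPrime 3).mpr
      (WeierstrassCurve.HasMultiplicativeReduction.not_hasGoodReduction (R := ℤ_[3]) hmult)
  have hH3 : SatisfiesHeegnerHypothesis 3 K := hHN.of_dvd h3N
  have h2split : ((Ideal.span {(2 : ℤ)}).primesOver (𝓞 K)).ncard = 2 := by
    simpa only [Nat.cast_ofNat] using hHN 2 Nat.prime_two h2N
  have hd8 : NumberField.discr K % 8 = 1 := (Literature.NumberTheory.QuadraticFields.Quadratic.ncard_primesOver_two_eq_two_iff hK.1).mp h2split
  have hodd : Odd (NumberField.discr K) := Int.odd_iff.mpr (by omega)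
  have hneg : NumberField.discr K < 0 := IsImaginaryQuadratic.discr_neg hK
  have hlt : NumberField.discr K < -4 := by
    have h4 : (4 : ℤ) < ((NumberField.discr K).natAbs : ℤ) := by exact_mod_cast hdisc
    omega
  exact ⟨K, inferInstance, inferInstance, Wd, inferInstance, hCd, Cd, ⟨hK, hodd, hlt, hHN, hH3, hLt, hWd⟩, hd8, q, hq, hv⟩

end Summit.BirchSwinnertonDyer.BirchSwinnertonDyer.Theorems.CornerTwinHalves
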